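import Mathlib
import HarnessLib
import Literature.Probability.LatticeModels.TorusFourierWeightedL1Prod
import Literature.Probability.LatticeModels.SampledSymbolDifferences
import Literature.MathematicalPhysics.QuantumLattice.HubbardSliceSymbolDifferences
import Summits.HubbardSuperconductivity.HubbardSuperconductivity.Theorems.KLProgrammeKLRegimeTorusAdditiveWeightSum

/-!
# Route `KLProgramme` — engine support (route (L2), ADDITIVE weight): the `ℓ¹` norm of a space-time character sum from the sup, the support
# count and POINTWISE single-direction second differences of its symbol (time, two axes, integer frame `(v⊥, v)`) — the master lemma

Cell `gate-hubbard-kl`, seat hubbard-kl-k3c2-p3 (row «sector-counting import (DR2000 L11/L12) for the leg-dress bar»), for the ENGINE child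
stmt-HubbardSuperconductivity-19823 (`stub_engine_step_norms`: the propagator constant `α_n` of `hubbardSectorKernelNorm_effAction_le_of_sectorNorm`;
also the sector-multiplier overlap size `B` of HOME/prover-p4/FRAME-L22-NOTE.md §2 — both are `ℓ¹` norms of product-torus character sums
`S(z) = Σ_q χ_{q₁}(z₁) χ_{q₂}(z₂) • G(q)` over `(ℤ/Pℤ)¹ × (ℤ/Lℤ)²`, `HubbardSpaceTimeCharacters.norm_pullback_normalCovariance_le`).

Assembling Literature's `ℓ²` route with the ADDITIVE order-two weight (`TorusFourierWeightedL1Prod.sum_sum_norm_prodChar_le`, `N = 2`, directions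
`u = 1` in time and `e₁, e₂, v⊥, v` in space, coefficients `c_w = (s_w P_w/4)⁴`) with the anisotropic inverse-weight sum
`KLProgrammeKLRegimeTorusAdditiveWeightSum.sum_inv_additiveQuarticWeight_le`:

  **`sum_norm_charSum_le_of_second_differences`** — if `‖G‖ ≤ A₀`, `#{G ≠ 0} ≤ N_s`, and for each of the five directions `w` the second
  difference obeys `‖Δ_w² G‖ ≤ A₀·(4/(s_w P_w))²` POINTWISE (`P_w = P` for time, `L` for space), then
  `Σ_z ‖S(z)‖ ≤ √(2048(1/s₀+1)[4(2√2/(s₂|v|)+2)(2√2/(s₃|v|)+2) + 16(1/s₁+1)²/(1+s₁R₀)]) · √(16·P·L²·N_s) · A₀`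
  for every near radius `R₀` with `2(|v₁|+|v₂|)R₀ < L`.

With the scales of a sector propagator at `Λ_n = e₀4^{-n}` on a frame (`A₀ ≍ (βL²)⁻¹Λ_n⁻¹`, `N_s ≍ βL²Λ_n²2^{-n}`, `s₀ ≍ Λ_nβ/P`, `s₁ ≍ s₂|v| ≍ Λ_n`,
`s₃|v| ≍ 2^{-n}`) this is `Σ_z |g(z)| ≲ (P/β)·Λ_n⁻¹`, i.e. `ε_x·α_n ≲ γ^{-h}` (Benfatto–Giuliani–Mastropietro 2006 (2.81); Disertori–Rivasseau 2000
Lemma 4 / Lemma 12).  Only SINGLE-direction second differences enter, so on an admissible frame only `C²` data of the band are used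
(`FrameOK` (i)); the symbol-side inputs are supplied per family by the slice-propagator / sector-multiplier files.
Everything is proved; no definitions, no named facts. [folklore]

References: G. Benfatto, A. Giuliani, V. Mastropietro, Ann. Henri Poincaré 7 (2006) 809–898, Lemma 2.2, (2.81) and footnote ¹; M. Disertori,
V. Rivasseau, Comm. Math. Phys. 215 (2000) 251–290, §IV.2 Lemma 4, App. A Lemma 12.
-/

noncomputable section

namespace Summit.HubbardSuperconductivity.HubbardSuperconductivity.Theorems.TorusFourierL2

set_option linter.dupNamespace false -- summit = problem name (single-conjunct summit), D-0017

open Finset Literature.Probability.LatticeModels Literature.MathematicalPhysics.QuantumLattice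
open scoped Real

/-! ### §1 `ℓ²` sums from pointwise bounds and a support count -/

/-- `Σ_x ‖G x‖² ≤ N_s·A₀²` when `‖G‖ ≤ A₀` and `#{G ≠ 0} ≤ N_s`. [folklore] -/
theorem sum_norm_sq_le_of_support_card {α : Type*} [Fintype α] [DecidableEq α] (G : α → ℂ) {Ns : ℕ}
    (hsupp : (univ.filter fun x => G x ≠ 0).card ≤ Ns) {A₀ : ℝ} (hG : ∀ x, ‖G x‖ ≤ A₀) :
    ∑ x, ‖G x‖ ^ 2 ≤ Ns * A₀ ^ 2 := by
  classical
  have hsplit : ∑ x, ‖G x‖ ^ 2 = ∑ x ∈ univ.filter (fun x => G x ≠ 0), ‖G x‖ ^ 2 := by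
    rw [sum_filter]
    refine sum_congr rfl fun x _ => ?_
    split_ifs with h
    · rfl
    · rw [not_ne_iff] at h
      rw [h, norm_zero]
      norm_num
  rw [hsplit]
  calc ∑ x ∈ univ.filter (fun x => G x ≠ 0), ‖G x‖ ^ 2 ≤ ∑ _x ∈ univ.filter (fun x => G x ≠ 0), A₀ ^ 2 :=
        sum_le_sum fun x _ => pow_le_pow_left₀ (norm_nonneg _) (hG x) 2
    _ = ((univ.filter fun x => G x ≠ 0).card : ℝ) * A₀ ^ 2 := by rw [sum_const, nsmul_eq_mul]
    _ ≤ Ns * A₀ ^ 2 := by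
        have hc : ((univ.filter fun x => G x ≠ 0).card : ℝ) ≤ Ns := by exact_mod_cast hsupp
        exact mul_le_mul_of_nonneg_right hc (sq_nonneg _)

/-- The support of a second difference is contained in three translates of the support:
`#{Δ_w² G ≠ 0} ≤ 3·#{G ≠ 0}`. [folklore] -/
theorem card_support_fwdDiff_two_le {α : Type*} [AddCommGroup α] [Fintype α] [DecidableEq α] (G : α → ℂ) (w : α) :
    (univ.filter fun x => (fwdDiff w)^[2] G x ≠ 0).card ≤ 3 * (univ.filter fun x => G x ≠ 0).card := by
  classical
  set S := univ.filter (fun x => G x ≠ 0) with hS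
  set T3 := (range 3).biUnion (fun j => S.image fun x => x - j • w) with hT3
  have hsub : (univ.filter fun x => (fwdDiff w)^[2] G x ≠ 0) ⊆ T3 := by
    intro x hx
    have h := (mem_filter.1 hx).2
    obtain ⟨j, hj, hne⟩ := exists_ne_zero_of_fwdDiff_iter_two_ne_zero w G x h
    rw [hT3, mem_biUnion]
    exact ⟨j, mem_range.2 hj, mem_image.2 ⟨x + j • w, mem_filter.2 ⟨mem_univ _, hne⟩, by simp⟩⟩
  calc (univ.filter fun x => (fwdDiff w)^[2] G x ≠ 0).card ≤ T3.card := card_le_card hsub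
    _ ≤ ∑ j ∈ range 3, (S.image fun x => x - j • w).card := card_biUnion_le
    _ ≤ ∑ _j ∈ range 3, S.card := sum_le_sum fun j _ => card_image_le
    _ = 3 * S.card := by rw [sum_const, card_range, smul_eq_mul]

/-- `Σ_x ‖Δ_w² G x‖² ≤ 3·N_s·B²` when `‖Δ_w² G‖ ≤ B` pointwise and `#{G ≠ 0} ≤ N_s`. [folklore] -/
theorem sum_norm_sq_fwdDiff_two_le {α : Type*} [AddCommGroup α] [Fintype α] [DecidableEq α] (G : α → ℂ) (w : α) {Ns : ℕ}
    (hsupp : (univ.filter fun x => G x ≠ 0).card ≤ Ns) {B : ℝ} (hB : ∀ x, ‖(fwdDiff w)^[2] G x‖ ≤ B) :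
    ∑ x, ‖(fwdDiff w)^[2] G x‖ ^ 2 ≤ 3 * Ns * B ^ 2 := by
  have h := sum_norm_sq_le_of_support_card ((fwdDiff w)^[2] G) ((card_support_fwdDiff_two_le G w).trans
    (Nat.mul_le_mul_left 3 hsupp)) hB
  refine h.trans (le_of_eq ?_)
  push_cast; ring

/-! ### §2 The master lemma -/

/-- Reindexing: the pair form of a product-torus character sum is the curried double sum. [folklore] -/
theorem charSum_pair_eq_curried {P L : ℕ} [NeZero P] [NeZero L] (G : TorusSite 1 P × TorusSite 2 L → ℂ)
    (z : TorusSite 1 P × TorusSite 2 L) :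
    ∑ q : TorusSite 1 P × TorusSite 2 L, (torusChar q.1 z.1 * torusChar q.2 z.2) • G q =
      ∑ p : TorusSite 1 P, ∑ p' : TorusSite 2 L, torusChar p z.1 * torusChar p' z.2 * (fun a b => G (a, b)) p p' := by
  rw [Fintype.sum_prod_type]
  refine sum_congr rfl fun p _ => sum_congr rfl fun p' _ => ?_
  rw [smul_eq_mul]

/-- **The `ℓ¹` norm of a space-time character sum from the sup, the support count and pointwise single-direction second differences of
its symbol.**  Data: rates `s₀, s₁, s₂, s₃ > 0`, an integer direction `v ≠ 0` with frame `(v⊥, v)`, a near radius `R₀` with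
`2(|v₁|+|v₂|)R₀ < L`; a symbol `G` on `(ℤ/Pℤ)¹ × (ℤ/Lℤ)²` with `‖G‖ ≤ A₀`, `#{G ≠ 0} ≤ N_s`, and
`‖Δ²_{(1,0)} G‖ ≤ A₀(4/(s₀P))²`, `‖Δ²_{(0,eᵢ)} G‖ ≤ A₀(4/(s₁L))²` (`i = 1,2`), `‖Δ²_{(0,v⊥)} G‖ ≤ A₀(4/(s₂L))²`, `‖Δ²_{(0,v)} G‖ ≤ A₀(4/(s₃L))²`.
THEN `Σ_z ‖Σ_q χ_{q₁}(z₁)χ_{q₂}(z₂) • G(q)‖ ≤ √(2048(1/s₀+1)[4(2√2/(s₂|v|)+2)(2√2/(s₃|v|)+2) + 16(1/s₁+1)²/(1+s₁R₀)])·√(16·P·L²·N_s)·A₀`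
(Cauchy–Schwarz with the additive quartic weight, Plancherel with second differences, and `sum_inv_additiveQuarticWeight_le`).
[cite: BenfattoGiulianiMastropietro2006, §2.6 (2.81) and footnote 1] -/
theorem sum_norm_charSum_le_of_second_differences {P L : ℕ} [NeZero P] [NeZero L] (G : TorusSite 1 P × TorusSite 2 L → ℂ)
    (v : Fin 2 → ℤ) (hv : v ≠ 0) {s₀ s₁ s₂ s₃ : ℝ} (hs₀ : 0 < s₀) (hs₁ : 0 < s₁) (hs₂ : 0 < s₂) (hs₃ : 0 < s₃)
    {R₀ : ℕ} (hR₀ : 2 * (|v 0| + |v 1|) * (R₀ : ℤ) < L) {A₀ : ℝ} (hA₀ : 0 ≤ A₀) {Ns : ℕ}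
    (hsupp : (univ.filter fun q => G q ≠ 0).card ≤ Ns) (hsup : ∀ q, ‖G q‖ ≤ A₀)
    (h₀ : ∀ q, ‖(fwdDiff ((fun _ : Fin 1 => (1 : ZMod P)), (0 : TorusSite 2 L)))^[2] G q‖ ≤ A₀ * (4 / (s₀ * P)) ^ 2)
    (h₁ : ∀ q (i : Fin 2), ‖(fwdDiff ((0 : TorusSite 1 P), (Pi.single i (1 : ZMod L) : TorusSite 2 L)))^[2] G q‖ ≤
      A₀ * (4 / (s₁ * L)) ^ 2)
    (h₂ : ∀ q, ‖(fwdDiff ((0 : TorusSite 1 P), (fun j => ((![-v 1, v 0] j : ℤ) : ZMod L))))^[2] G q‖ ≤ A₀ * (4 / (s₂ * L)) ^ 2)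
    (h₃ : ∀ q, ‖(fwdDiff ((0 : TorusSite 1 P), (fun j => ((v j : ℤ) : ZMod L))))^[2] G q‖ ≤ A₀ * (4 / (s₃ * L)) ^ 2) :
    ∑ z : TorusSite 1 P × TorusSite 2 L, ‖∑ q : TorusSite 1 P × TorusSite 2 L, (torusChar q.1 z.1 * torusChar q.2 z.2) • G q‖ ≤
      Real.sqrt (2048 * (1 / s₀ + 1) *
          (4 * ((2 * Real.sqrt 2 / (s₂ * Real.sqrt ((v 0 : ℝ) ^ 2 + (v 1 : ℝ) ^ 2)) + 2) *
              (2 * Real.sqrt 2 / (s₃ * Real.sqrt ((v 0 : ℝ) ^ 2 + (v 1 : ℝ) ^ 2)) + 2))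
            + 16 * (1 / s₁ + 1) ^ 2 / (1 + s₁ * R₀))) *
        Real.sqrt (16 * P * (L : ℝ) ^ 2 * Ns) * A₀ := by
  classical
  -- the four space directions, indexed by `Fin 4`: e₁, e₂, v⊥, v
  obtain ⟨dir, hdir⟩ : ∃ dir : Fin 4 → TorusSite 2 L, dir = ![(Pi.single 0 (1 : ZMod L) : TorusSite 2 L),
    (Pi.single 1 (1 : ZMod L) : TorusSite 2 L), (fun j => ((![-v 1, v 0] j : ℤ) : ZMod L)), (fun j => ((v j : ℤ) : ZMod L))] :=
    ⟨_, rfl⟩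
  obtain ⟨rate, hrate⟩ : ∃ rate : Fin 4 → ℝ, rate = ![s₁, s₁, s₂, s₃] := ⟨_, rfl⟩
  obtain ⟨u, hu⟩ : ∃ u : TorusSite 1 P, u = fun _ => (1 : ZMod P) := ⟨_, rfl⟩
  obtain ⟨c₀, hc₀⟩ : ∃ c₀ : ℝ, c₀ = (s₀ * P / 4) ^ 4 := ⟨_, rfl⟩
  obtain ⟨c, hc⟩ : ∃ c : Fin 4 → ℝ, c = fun i => (rate i * L / 4) ^ 4 := ⟨_, rfl⟩
  have hrate_pos : ∀ i, 0 < rate i := fun i => by subst hrate; fin_cases i <;> simp [hs₁, hs₂, hs₃]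
  have hc₀0 : 0 ≤ c₀ := by rw [hc₀]; positivity
  have hci0 : ∀ i, 0 ≤ c i := fun i => by rw [hc]; positivity
  have hc0 : ∀ i ∈ (univ : Finset (Fin 4)), 0 ≤ c i := fun i _ => hci0 i
  obtain ⟨Gc, hGc⟩ : ∃ Gc : TorusSite 1 P → TorusSite 2 L → ℂ, Gc = fun a b => G (a, b) := ⟨_, rfl⟩
  -- Literature's ℓ² route with the additive weight
  have hmain := sum_sum_norm_prodChar_le (univ : Finset (Fin 4)) u c₀ hc₀0 dir c hc0 2 Gc
  -- (1) rewrite the left-hand side into the pair form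
  have hLHS : ∑ z : TorusSite 1 P × TorusSite 2 L, ‖∑ q : TorusSite 1 P × TorusSite 2 L, (torusChar q.1 z.1 * torusChar q.2 z.2) • G q‖ =
      ∑ a : TorusSite 1 P, ∑ b : TorusSite 2 L, ‖∑ p, ∑ p', torusChar p a * torusChar p' b * Gc p p'‖ := by
    rw [Fintype.sum_prod_type]
    refine sum_congr rfl fun a _ => sum_congr rfl fun b _ => ?_
    rw [charSum_pair_eq_curried, hGc]
  rw [hLHS]
  refine hmain.trans ?_
  -- (2) the weight factor: identify the weight with the additive quartic weight
  have hP : (0 : ℝ) < P := Nat.cast_pos.2 (Nat.pos_of_ne_zero (NeZero.ne P))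
  have hL : (0 : ℝ) < L := Nat.cast_pos.2 (Nat.pos_of_ne_zero (NeZero.ne L))
  have hweight_eq : ∀ (a : TorusSite 1 P) (b : TorusSite 2 L),
      (1 + c₀ * (4 * |((∑ j, u j * a j).valMinAbs : ℝ)| / P) ^ (2 * 2) +
        ∑ i ∈ (univ : Finset (Fin 4)), c i * (4 * |((∑ j, dir i j * b j).valMinAbs : ℝ)| / L) ^ (2 * 2)) =
      1 + (s₀ * |(((a 0).valMinAbs : ℤ) : ℝ)|) ^ 4 + (s₁ * |(((b 0).valMinAbs : ℤ) : ℝ)|) ^ 4 +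
        (s₁ * |(((b 1).valMinAbs : ℤ) : ℝ)|) ^ 4 +
        (s₂ * |(((∑ j, ((![-v 1, v 0] j : ℤ) : ZMod L) * b j).valMinAbs : ℤ) : ℝ)|) ^ 4 +
        (s₃ * |(((∑ j, ((v j : ℤ) : ZMod L) * b j).valMinAbs : ℤ) : ℝ)|) ^ 4 := by
    intro a b
    have hua : (∑ j, u j * a j) = a 0 := by simp [hu]
    have hb0 : (∑ j, dir 0 j * b j) = b 0 := by simp [hdir, Pi.single_apply]
    have hb1 : (∑ j, dir 1 j * b j) = b 1 := by simp [hdir, Pi.single_apply]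
    have hb2 : (∑ j, dir 2 j * b j) = ∑ j, ((![-v 1, v 0] j : ℤ) : ZMod L) * b j := by simp [hdir]
    have hb3 : (∑ j, dir 3 j * b j) = ∑ j, ((v j : ℤ) : ZMod L) * b j := by simp [hdir]
    rw [Fin.sum_univ_four, hua, hb0, hb1, hb2, hb3, hc, hc₀]
    have hr0 : rate 0 = s₁ := by rw [hrate]; rfl
    have hr1 : rate 1 = s₁ := by rw [hrate]; rfl
    have hr2 : rate 2 = s₂ := by rw [hrate]; rfl
    have hr3 : rate 3 = s₃ := by rw [hrate]; rfl
    simp only [hr0, hr1, hr2, hr3]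
    have key : ∀ (s Q x : ℝ), 0 < Q → (s * Q / 4) ^ 4 * (4 * x / Q) ^ (2 * 2) = (s * x) ^ 4 := by
      intro s Q x hQ
      rw [show 2 * 2 = 4 by norm_num, ← mul_pow]
      congr 1
      field_simp
    rw [key _ _ _ hP, key _ _ _ hL, key _ _ _ hL, key _ _ _ hL, key _ _ _ hL]
    ring
  have hW := sum_inv_additiveQuarticWeight_le (P := P) (L := L) v hv hs₀ hs₁ hs₂ hs₃ hR₀
  have hweight : Real.sqrt (∑ a : TorusSite 1 P, ∑ b : TorusSite 2 L,
      (1 + c₀ * (4 * |((∑ j, u j * a j).valMinAbs : ℝ)| / P) ^ (2 * 2) +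
        ∑ i ∈ (univ : Finset (Fin 4)), c i * (4 * |((∑ j, dir i j * b j).valMinAbs : ℝ)| / L) ^ (2 * 2))⁻¹) ≤
      Real.sqrt (2048 * (1 / s₀ + 1) *
          (4 * ((2 * Real.sqrt 2 / (s₂ * Real.sqrt ((v 0 : ℝ) ^ 2 + (v 1 : ℝ) ^ 2)) + 2) *
              (2 * Real.sqrt 2 / (s₃ * Real.sqrt ((v 0 : ℝ) ^ 2 + (v 1 : ℝ) ^ 2)) + 2))
            + 16 * (1 / s₁ + 1) ^ 2 / (1 + s₁ * R₀))) := by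
    refine Real.sqrt_le_sqrt ?_
    simp_rw [hweight_eq]
    rw [← Fintype.sum_prod_type']
    exact hW
  -- (3) the symbol factor
  have hsq0 : ∑ p, ∑ p', ‖Gc p p'‖ ^ 2 ≤ Ns * A₀ ^ 2 := by
    rw [← Fintype.sum_prod_type' (f := fun p p' => ‖Gc p p'‖ ^ 2), hGc]
    exact sum_norm_sq_le_of_support_card G hsupp hsup
  have htime : c₀ * ∑ p, ∑ p', ‖((fwdDiff u)^[2] (fun q => Gc q p')) p‖ ^ 2 ≤ 3 * Ns * A₀ ^ 2 := by
    have hpt : ∀ q : TorusSite 1 P × TorusSite 2 L, ‖(fwdDiff (u, (0 : TorusSite 2 L)))^[2] G q‖ ≤ A₀ * (4 / (s₀ * P)) ^ 2 :=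
      fun q => by rw [hu]; exact h₀ q
    have h := sum_norm_sq_fwdDiff_two_le G (u, (0 : TorusSite 2 L)) hsupp hpt
    have heq : ∑ p, ∑ p', ‖((fwdDiff u)^[2] (fun q => Gc q p')) p‖ ^ 2 =
        ∑ q : TorusSite 1 P × TorusSite 2 L, ‖(fwdDiff (u, (0 : TorusSite 2 L)))^[2] G q‖ ^ 2 := by
      rw [Fintype.sum_prod_type]
      refine sum_congr rfl fun p _ => sum_congr rfl fun p' _ => ?_
      rw [fwdDiff_iter_prod_fst, hGc]
    rw [heq]
    calc c₀ * ∑ q : TorusSite 1 P × TorusSite 2 L, ‖(fwdDiff (u, (0 : TorusSite 2 L)))^[2] G q‖ ^ 2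
        ≤ c₀ * (3 * Ns * (A₀ * (4 / (s₀ * P)) ^ 2) ^ 2) := mul_le_mul_of_nonneg_left h hc₀0
      _ = 3 * Ns * A₀ ^ 2 := by
          rw [hc₀]
          have : (s₀ * P / 4) ^ 4 * ((4 / (s₀ * P)) ^ 2) ^ 2 = 1 := by
            rw [← pow_mul, show 2 * 2 = 4 by norm_num, ← mul_pow]
            have : s₀ * P / 4 * (4 / (s₀ * P)) = 1 := by field_simp
            rw [this, one_pow]
          calc (s₀ * ↑P / 4) ^ 4 * (3 * ↑Ns * (A₀ * (4 / (s₀ * ↑P)) ^ 2) ^ 2)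
              = 3 * Ns * A₀ ^ 2 * ((s₀ * P / 4) ^ 4 * ((4 / (s₀ * P)) ^ 2) ^ 2) := by ring
            _ = 3 * Ns * A₀ ^ 2 := by rw [this, mul_one]
  have hspace : ∀ i : Fin 4, c i * ∑ p, ∑ p', ‖((fwdDiff (dir i))^[2] (Gc p)) p'‖ ^ 2 ≤ 3 * Ns * A₀ ^ 2 := by
    intro i
    have hpt : ∀ q : TorusSite 1 P × TorusSite 2 L, ‖(fwdDiff ((0 : TorusSite 1 P), dir i))^[2] G q‖ ≤
        A₀ * (4 / (rate i * L)) ^ 2 := by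
      have hd0 : dir 0 = (Pi.single 0 (1 : ZMod L) : TorusSite 2 L) := by rw [hdir]; rfl
      have hd1 : dir 1 = (Pi.single 1 (1 : ZMod L) : TorusSite 2 L) := by rw [hdir]; rfl
      have hd2 : dir 2 = (fun j => ((![-v 1, v 0] j : ℤ) : ZMod L)) := by rw [hdir]; rfl
      have hd3 : dir 3 = (fun j => ((v j : ℤ) : ZMod L)) := by rw [hdir]; rfl
      have hr0 : rate 0 = s₁ := by rw [hrate]; rfl
      have hr1 : rate 1 = s₁ := by rw [hrate]; rfl
      have hr2 : rate 2 = s₂ := by rw [hrate]; rfl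
      have hr3 : rate 3 = s₃ := by rw [hrate]; rfl
      intro q
      fin_cases i
      · change ‖(fwdDiff ((0 : TorusSite 1 P), dir 0))^[2] G q‖ ≤ A₀ * (4 / (rate 0 * L)) ^ 2
        rw [hd0, hr0]; exact h₁ q 0
      · change ‖(fwdDiff ((0 : TorusSite 1 P), dir 1))^[2] G q‖ ≤ A₀ * (4 / (rate 1 * L)) ^ 2
        rw [hd1, hr1]; exact h₁ q 1
      · change ‖(fwdDiff ((0 : TorusSite 1 P), dir 2))^[2] G q‖ ≤ A₀ * (4 / (rate 2 * L)) ^ 2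
        rw [hd2, hr2]; exact h₂ q
      · change ‖(fwdDiff ((0 : TorusSite 1 P), dir 3))^[2] G q‖ ≤ A₀ * (4 / (rate 3 * L)) ^ 2
        rw [hd3, hr3]; exact h₃ q
    have h := sum_norm_sq_fwdDiff_two_le G ((0 : TorusSite 1 P), dir i) hsupp hpt
    have heq : ∑ p, ∑ p', ‖((fwdDiff (dir i))^[2] (Gc p)) p'‖ ^ 2 =
        ∑ q : TorusSite 1 P × TorusSite 2 L, ‖(fwdDiff ((0 : TorusSite 1 P), dir i))^[2] G q‖ ^ 2 := by
      rw [Fintype.sum_prod_type]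
      refine sum_congr rfl fun p _ => sum_congr rfl fun p' _ => ?_
      rw [fwdDiff_iter_prod_snd, hGc]
    rw [heq]
    have hri := hrate_pos i
    calc c i * ∑ q : TorusSite 1 P × TorusSite 2 L, ‖(fwdDiff ((0 : TorusSite 1 P), dir i))^[2] G q‖ ^ 2
        ≤ c i * (3 * Ns * (A₀ * (4 / (rate i * L)) ^ 2) ^ 2) := mul_le_mul_of_nonneg_left h (hc0 i (mem_univ _))
      _ = 3 * Ns * A₀ ^ 2 := by
          rw [hc]
          have : (rate i * L / 4) ^ 4 * ((4 / (rate i * L)) ^ 2) ^ 2 = 1 := by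
            rw [← pow_mul, show 2 * 2 = 4 by norm_num, ← mul_pow]
            have : rate i * L / 4 * (4 / (rate i * L)) = 1 := by field_simp
            rw [this, one_pow]
          calc (rate i * ↑L / 4) ^ 4 * (3 * ↑Ns * (A₀ * (4 / (rate i * ↑L)) ^ 2) ^ 2)
              = 3 * Ns * A₀ ^ 2 * ((rate i * L / 4) ^ 4 * ((4 / (rate i * L)) ^ 2) ^ 2) := by ring
            _ = 3 * Ns * A₀ ^ 2 := by rw [this, mul_one]
  have hsymbol : Real.sqrt ((P : ℝ) ^ 1 * (L : ℝ) ^ 2 *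
      (∑ p, ∑ p', ‖Gc p p'‖ ^ 2 + c₀ * ∑ p, ∑ p', ‖((fwdDiff u)^[2] (fun q => Gc q p')) p‖ ^ 2 +
        ∑ i ∈ (univ : Finset (Fin 4)), c i * ∑ p, ∑ p', ‖((fwdDiff (dir i))^[2] (Gc p)) p'‖ ^ 2)) ≤
      Real.sqrt (16 * P * (L : ℝ) ^ 2 * Ns) * A₀ := by
    have hbr : ∑ p, ∑ p', ‖Gc p p'‖ ^ 2 + c₀ * ∑ p, ∑ p', ‖((fwdDiff u)^[2] (fun q => Gc q p')) p‖ ^ 2 +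
        ∑ i ∈ (univ : Finset (Fin 4)), c i * ∑ p, ∑ p', ‖((fwdDiff (dir i))^[2] (Gc p)) p'‖ ^ 2 ≤ 16 * Ns * A₀ ^ 2 := by
      have h4 : ∑ i ∈ (univ : Finset (Fin 4)), c i * ∑ p, ∑ p', ‖((fwdDiff (dir i))^[2] (Gc p)) p'‖ ^ 2 ≤
          ∑ _i ∈ (univ : Finset (Fin 4)), 3 * Ns * A₀ ^ 2 := sum_le_sum fun i _ => hspace i
      rw [sum_const, card_univ, Fintype.card_fin, nsmul_eq_mul] at h4
      push_cast at h4
      linarith [hsq0, htime, h4]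
    rw [← Real.sqrt_sq hA₀, ← Real.sqrt_mul (by positivity)]
    refine Real.sqrt_le_sqrt ?_
    rw [pow_one]
    calc (P : ℝ) * (L : ℝ) ^ 2 * _ ≤ (P : ℝ) * (L : ℝ) ^ 2 * (16 * Ns * A₀ ^ 2) :=
          mul_le_mul_of_nonneg_left hbr (by positivity)
      _ = 16 * P * (L : ℝ) ^ 2 * Ns * A₀ ^ 2 := by ring
  calc _ ≤ Real.sqrt (2048 * (1 / s₀ + 1) *
          (4 * ((2 * Real.sqrt 2 / (s₂ * Real.sqrt ((v 0 : ℝ) ^ 2 + (v 1 : ℝ) ^ 2)) + 2) *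
              (2 * Real.sqrt 2 / (s₃ * Real.sqrt ((v 0 : ℝ) ^ 2 + (v 1 : ℝ) ^ 2)) + 2))
            + 16 * (1 / s₁ + 1) ^ 2 / (1 + s₁ * R₀))) * (Real.sqrt (16 * P * (L : ℝ) ^ 2 * Ns) * A₀) :=
        mul_le_mul hweight hsymbol (Real.sqrt_nonneg _) (Real.sqrt_nonneg _)
    _ = _ := by ring

end Summit.HubbardSuperconductivity.HubbardSuperconductivity.Theorems.TorusFourierL2

end
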